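import Summits.CriticalPhenomena.CardyFormulaZ2.Theorems.CardyUniqueLimitCardyRigidityFarFieldIntegrals

/-!
# Moments of the stopped-modulus increment from its far-field expansion (line `crossing-martingale`, crux `CardyRigidity`)

Probabilistic layer of the far-field MOMENT engine (stubs `stub_betaPinning` /
`stub_kernelAffineBeta`, crux `CardyRigidity`, stmt-CriticalPhenomena-0746), in ABSTRACT form: let
`X` be a real random variable dominated by `B ∈ L³` (`B ≥ 0` strongly measurable) on a probability
space, and `h n` measurable random variables (the increments of the stopped modulus at scale `n`)
such that, with `q n = n^{3/4}`,

* (sure)  `|h n| ≤ C q n / n` everywhere, for large `n`;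
* (good)  almost surely, on `{B ≤ q n/2}`:
  `|h n - D n + S n · X/n + P n · X²/n²| ≤ C' (B³ + B + 1)/n³`, for large `n`,

with deterministic `S n → S₀`, `P n → P₀`, `n² D n → D₀`.  THEN (`tendsto_first_moment`,
`tendsto_second_moment`, `tendsto_first_moment_of_centered`):

  `n E[h n] → -S₀ E[X]`,  `n² E[(h n)²] → S₀² E[X²]`,  and if `E[X] = 0`: `n² E[h n] → D₀ - P₀ E[X²]`.

The proofs split every integral over the good event and its complement (Markov:
`μ{B > q/2} ≤ 8 E[B³]/q³`), use the pathwise bounds on the good event and the sure bound on the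
complement, and the elementary rates `q/n = n^{-1/4} → 0`, `n/q² = n^{-1/2} → 0`.
The instantiation with the pathwise far-field lemmas (`…FarFieldPathwise`) is in the sequel.
-/

noncomputable section

open MeasureTheory Filter Set Topology
open scoped NNReal ENNReal

namespace Summit.CriticalPhenomena.CardyFormulaZ2.Cruxes.CardyRigidity.CrossingMartingale

namespace FarField

/-! ### Deterministic rates of the scale `q n = n^{3/4}` -/

/-- `n^{-p} → 0` along the naturals (`p > 0`). [folklore] -/
theorem tendsto_natCast_rpow_neg {p : ℝ} (hp : 0 < p) :
    Tendsto (fun n : ℕ ↦ ((n : ℝ)) ^ (-p)) atTop (𝓝 0) :=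
  (tendsto_rpow_neg_atTop hp).comp tendsto_natCast_atTop_atTop

/-- `q/n → 0` for `q = n^{3/4}`. [folklore] -/
theorem tendsto_scale_div : Tendsto (fun n : ℕ ↦ ((n : ℝ)) ^ (3 / 4 : ℝ) / n) atTop (𝓝 0) := by
  refine (tendsto_natCast_rpow_neg (by norm_num : (0 : ℝ) < 1 / 4)).congr' ?_
  filter_upwards [eventually_gt_atTop 0] with n hn
  have hnpos : (0 : ℝ) < n := by exact_mod_cast hn
  rw [eq_div_iff hnpos.ne', ← Real.rpow_add_one hnpos.ne']
  norm_num

/-- `n/q² → 0` for `q = n^{3/4}`. [folklore] -/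
theorem tendsto_div_scale_sq :
    Tendsto (fun n : ℕ ↦ (n : ℝ) / (((n : ℝ)) ^ (3 / 4 : ℝ)) ^ 2) atTop (𝓝 0) := by
  refine (tendsto_natCast_rpow_neg (by norm_num : (0 : ℝ) < 1 / 2)).congr' ?_
  filter_upwards [eventually_gt_atTop 0] with n hn
  have hnpos : (0 : ℝ) < n := by exact_mod_cast hn
  have hq : (((n : ℝ)) ^ (3 / 4 : ℝ)) ^ 2 = (n : ℝ) ^ (3 / 2 : ℝ) := by
    rw [← Real.rpow_natCast, ← Real.rpow_mul hnpos.le]; norm_num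
  rw [hq, eq_div_iff (Real.rpow_pos_of_pos hnpos _).ne', ← Real.rpow_add hnpos]
  norm_num

/-- `1/q → 0` for `q = n^{3/4}`. [folklore] -/
theorem tendsto_inv_scale : Tendsto (fun n : ℕ ↦ (((n : ℝ)) ^ (3 / 4 : ℝ))⁻¹) atTop (𝓝 0) := by
  refine (tendsto_natCast_rpow_neg (by norm_num : (0 : ℝ) < 3 / 4)).congr' ?_
  filter_upwards [eventually_gt_atTop 0] with n hn
  have hnpos : (0 : ℝ) < n := by exact_mod_cast hn
  rw [Real.rpow_neg hnpos.le]

/-- `1/q² → 0` for `q = n^{3/4}`. [folklore] -/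
theorem tendsto_inv_scale_sq :
    Tendsto (fun n : ℕ ↦ ((((n : ℝ)) ^ (3 / 4 : ℝ)) ^ 2)⁻¹) atTop (𝓝 0) := by
  have := tendsto_inv_scale.pow 2
  simpa [inv_pow] using this

/-- `1/n → 0` along the naturals (real form). [folklore] -/
theorem tendsto_inv_natCast : Tendsto (fun n : ℕ ↦ ((n : ℝ))⁻¹) atTop (𝓝 0) :=
  tendsto_inv_atTop_zero.comp tendsto_natCast_atTop_atTop

/-- From `n² Dₙ → D₀`: `n Dₙ → 0`. [folklore] -/
theorem tendsto_mul_of_tendsto_sq_mul {D : ℕ → ℝ} {D₀ : ℝ}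
    (hD : Tendsto (fun n : ℕ ↦ (n : ℝ) ^ 2 * D n) atTop (𝓝 D₀)) :
    Tendsto (fun n : ℕ ↦ (n : ℝ) * D n) atTop (𝓝 0) := by
  have h := hD.mul tendsto_inv_natCast
  rw [mul_zero] at h
  refine h.congr' ?_
  filter_upwards [eventually_gt_atTop 0] with n hn
  have hnpos : (0 : ℝ) < n := by exact_mod_cast hn
  field_simp

/-- From `n² Dₙ → D₀`: `Dₙ → 0`. [folklore] -/
theorem tendsto_of_tendsto_sq_mul {D : ℕ → ℝ} {D₀ : ℝ}
    (hD : Tendsto (fun n : ℕ ↦ (n : ℝ) ^ 2 * D n) atTop (𝓝 D₀)) :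
    Tendsto D atTop (𝓝 0) := by
  have h := (tendsto_mul_of_tendsto_sq_mul hD).mul tendsto_inv_natCast
  rw [zero_mul] at h
  refine h.congr' ?_
  filter_upwards [eventually_gt_atTop 0] with n hn
  have hnpos : (0 : ℝ) < n := by exact_mod_cast hn
  field_simp

/-- The thresholds `q n / 2` are monotone. [folklore] -/
theorem monotone_scale_half : Monotone fun n : ℕ ↦ ((n : ℝ)) ^ (3 / 4 : ℝ) / 2 := by
  intro i j hij
  have : ((i : ℝ)) ^ (3 / 4 : ℝ) ≤ ((j : ℝ)) ^ (3 / 4 : ℝ) :=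
    Real.rpow_le_rpow (Nat.cast_nonneg _) (by exact_mod_cast hij) (by norm_num)
  simpa using div_le_div_of_nonneg_right this zero_le_two

/-- The thresholds `q n / 2` tend to `∞`. [folklore] -/
theorem tendsto_scale_half_atTop : Tendsto (fun n : ℕ ↦ ((n : ℝ)) ^ (3 / 4 : ℝ) / 2) atTop atTop :=
  ((tendsto_rpow_atTop (by norm_num : (0 : ℝ) < 3 / 4)).comp
    tendsto_natCast_atTop_atTop).atTop_div_const two_pos

/-! ### The abstract moment theorems -/

section Moments

variable {Ω : Type*} {mΩ : MeasurableSpace Ω} {μ : Measure Ω} [IsProbabilityMeasure μ]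
  {X B : Ω → ℝ} {h : ℕ → Ω → ℝ} {S P D : ℕ → ℝ} {S₀ P₀ D₀ C C' : ℝ}

/-- A measurable function with a uniform bound is integrable (probability space). [folklore] -/
theorem integrable_of_abs_le {f : Ω → ℝ} (hf : Measurable f) {K : ℝ} (hK : ∀ ω, |f ω| ≤ K) :
    Integrable f μ :=
  Integrable.mono' (integrable_const K) hf.aestronglyMeasurable
    (Eventually.of_forall fun ω ↦ by rw [Real.norm_eq_abs]; exact hK ω)

/-- **First moment.**  Under the sure bound and the good-event expansion,
`n E[h n] → -S₀ E[X]`. [folklore] -/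
theorem tendsto_first_moment (hXm : Measurable X) (hBm : StronglyMeasurable B)
    (hB3 : MemLp B 3 μ) (hB0 : ∀ ω, 0 ≤ B ω) (hXB : ∀ᵐ ω ∂μ, |X ω| ≤ B ω)
    (hhm : ∀ᶠ n : ℕ in atTop, Measurable (h n))
    (hsure : ∀ᶠ n : ℕ in atTop, ∀ ω, |h n ω| ≤ C * ((n : ℝ)) ^ (3 / 4 : ℝ) / n)
    (hgood : ∀ᶠ n : ℕ in atTop, ∀ᵐ ω ∂μ, B ω ≤ ((n : ℝ)) ^ (3 / 4 : ℝ) / 2 →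
      |h n ω - D n + S n * (X ω / n) + P n * (X ω / n) ^ 2| ≤
        C' * (B ω ^ 3 + B ω + 1) / (n : ℝ) ^ 3)
    (hS : Tendsto S atTop (𝓝 S₀)) (hP : Tendsto P atTop (𝓝 P₀))
    (hD : Tendsto (fun n : ℕ ↦ (n : ℝ) ^ 2 * D n) atTop (𝓝 D₀)) :
    Tendsto (fun n : ℕ ↦ (n : ℝ) * ∫ ω, h n ω ∂μ) atTop (𝓝 (-(S₀ * ∫ ω, X ω ∂μ))) := by
  -- notation
  set q : ℕ → ℝ := fun n ↦ ((n : ℝ)) ^ (3 / 4 : ℝ) with hq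
  set G : ℕ → Set Ω := fun n ↦ {ω | B ω ≤ q n / 2} with hG
  have hGm : ∀ n, MeasurableSet (G n) := fun n ↦ measurableSet_good hBm _
  -- integrability
  have hIX : Integrable X μ := Integrable.mono' (integrable_of_memLp_three hB3)
    hXm.aestronglyMeasurable (by filter_upwards [hXB] with ω hω; rwa [Real.norm_eq_abs])
  have hIX2 : Integrable (fun ω ↦ X ω ^ 2) μ := by
    refine Integrable.mono' (integrable_sq_of_memLp_three hB3 hB0)
      (hXm.pow_const 2).aestronglyMeasurable ?_
    filter_upwards [hXB] with ω hω
    rw [Real.norm_eq_abs, abs_pow, sq_abs]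
    have := hB0 ω
    rw [abs_le] at hω
    nlinarith
  have hIB := integrable_of_memLp_three hB3
  have hIB3 := integrable_cube_of_memLp_three hB3 hB0
  set EB3 : ℝ := ∫ ω, B ω ^ 3 ∂μ with hEB3
  set Emom : ℝ := ∫ ω, (B ω ^ 3 + B ω + 1) ∂μ with hEmom
  have hImom : Integrable (fun ω ↦ B ω ^ 3 + B ω + 1) μ := (hIB3.add hIB).add (integrable_const _)
  -- the five terms
  set T₁ : ℕ → ℝ := fun n ↦ (n : ℝ) * D n * μ.real (G n) with hT₁
  set T₂ : ℕ → ℝ := fun n ↦ -(S n * ∫ ω in G n, X ω ∂μ) with hT₂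
  set T₃ : ℕ → ℝ := fun n ↦ -(P n / n * ∫ ω in G n, X ω ^ 2 ∂μ) with hT₃
  set ρ : ℕ → Ω → ℝ := fun n ω ↦ h n ω - D n + S n * (X ω / n) + P n * (X ω / n) ^ 2 with hρ
  set T₄ : ℕ → ℝ := fun n ↦ (n : ℝ) * ∫ ω in G n, ρ n ω ∂μ with hT₄
  set T₅ : ℕ → ℝ := fun n ↦ (n : ℝ) * ∫ ω in (G n)ᶜ, h n ω ∂μ with hT₅
  -- the decomposition, eventually
  have hdecomp : ∀ᶠ n : ℕ in atTop, (n : ℝ) * ∫ ω, h n ω ∂μ = T₁ n + T₂ n + T₃ n + T₄ n + T₅ n := by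
    filter_upwards [hhm, hsure, eventually_gt_atTop 0] with n hmn hsn hn0
    have hnpos : (0 : ℝ) < n := by exact_mod_cast hn0
    have hIh : Integrable (h n) μ := integrable_of_abs_le hmn (hsn)
    -- split over `G n` and its complement
    rw [← integral_add_compl (hGm n) hIh]
    -- on `G n`: `h = D - S X/n - P X²/n² + ρ`
    have hsplit : ∫ ω in G n, h n ω ∂μ = D n * μ.real (G n) - S n / n * ∫ ω in G n, X ω ∂μ
        - P n / (n : ℝ) ^ 2 * ∫ ω in G n, X ω ^ 2 ∂μ + ∫ ω in G n, ρ n ω ∂μ := by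
      have hIρ : Integrable (ρ n) μ := by
        simp only [hρ]
        refine ((hIh.sub (integrable_const _)).add ((hIX.div_const _).const_mul _)).add ?_
        have : (fun ω ↦ P n * (X ω / n) ^ 2) = fun ω ↦ P n / (n : ℝ) ^ 2 * X ω ^ 2 := by
          funext ω; ring
        rw [this]; exact hIX2.const_mul _
      have hfun : (fun ω ↦ h n ω) = fun ω ↦
          (D n - S n / n * X ω - P n / (n : ℝ) ^ 2 * X ω ^ 2) + ρ n ω := by
        funext ω; simp only [hρ]; ring
      rw [hfun, integral_add _ hIρ.integrableOn]
      · rw [integral_sub, integral_sub, integral_const_mul, integral_const_mul]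
        · simp only [setIntegral_const, smul_eq_mul, mul_comm (μ.real (G n))]
        · exact (integrable_const _).integrableOn
        · exact (hIX.const_mul _).integrableOn
        · exact ((integrable_const _).sub (hIX.const_mul _)).integrableOn
        · exact (hIX2.const_mul _).integrableOn
      · exact (((integrable_const _).sub (hIX.const_mul _)).sub (hIX2.const_mul _)).integrableOn
    rw [hsplit]
    simp only [hT₁, hT₂, hT₃, hT₄, hT₅]
    field_simp
    ring
  -- limits of the five terms
  have hL₁ : Tendsto T₁ atTop (𝓝 0) := by
    have h0 : Tendsto (fun n : ℕ ↦ |(n : ℝ) * D n|) atTop (𝓝 0) := by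
      simpa using (tendsto_mul_of_tendsto_sq_mul hD).abs
    refine squeeze_zero_norm' (a := fun n : ℕ ↦ |(n : ℝ) * D n|) ?_ h0
    filter_upwards with n
    simp only [hT₁, Real.norm_eq_abs, abs_mul]
    have : |μ.real (G n)| ≤ 1 := by
      rw [abs_of_nonneg measureReal_nonneg]; exact measureReal_le_one
    calc |(n : ℝ)| * |D n| * |μ.real (G n)| ≤ |(n : ℝ)| * |D n| * 1 := by gcongr
      _ = |(n : ℝ)| * |D n| := mul_one _
  have hL₂ : Tendsto T₂ atTop (𝓝 (-(S₀ * ∫ ω, X ω ∂μ))) :=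
    (hS.mul (tendsto_setIntegral_good hBm monotone_scale_half tendsto_scale_half_atTop hIX)).neg
  have hL₃ : Tendsto T₃ atTop (𝓝 0) := by
    have h0 : Tendsto (fun n : ℕ ↦ P n / n) atTop (𝓝 0) := by
      simpa [div_eq_mul_inv] using hP.mul tendsto_inv_natCast
    have hbd : ∀ n, |∫ ω in G n, X ω ^ 2 ∂μ| ≤ ∫ ω, X ω ^ 2 ∂μ := fun n ↦ by
      rw [abs_of_nonneg (setIntegral_nonneg (hGm n) fun ω _ ↦ sq_nonneg _)]
      exact setIntegral_le_integral hIX2 (Eventually.of_forall fun ω ↦ sq_nonneg _)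
    have h0' : Tendsto (fun n : ℕ ↦ |P n / n| * ∫ ω, X ω ^ 2 ∂μ) atTop (𝓝 0) := by
      simpa using (h0.abs.mul_const (∫ ω, X ω ^ 2 ∂μ))
    refine squeeze_zero_norm' (a := fun n : ℕ ↦ |P n / n| * ∫ ω, X ω ^ 2 ∂μ) ?_ h0'
    filter_upwards with n
    simp only [hT₃, norm_neg, Real.norm_eq_abs, abs_mul]
    exact mul_le_mul_of_nonneg_left (hbd n) (abs_nonneg _)
  have hL₄ : Tendsto T₄ atTop (𝓝 0) := by
    -- `|n ∫_G ρ| ≤ C' E[B³+B+1]/n²`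
    have h0 : Tendsto (fun n : ℕ ↦ |C'| * Emom * ((n : ℝ))⁻¹ ^ 2) atTop (𝓝 0) := by
      have := (tendsto_inv_natCast.pow 2).const_mul (|C'| * Emom)
      simpa using this
    refine squeeze_zero_norm' (a := fun n : ℕ ↦ |C'| * Emom * ((n : ℝ))⁻¹ ^ 2) ?_ h0
    filter_upwards [hgood, hhm, hsure, eventually_gt_atTop 0] with n hgn hmn hsn hn0
    have hnpos : (0 : ℝ) < n := by exact_mod_cast hn0
    rw [Real.norm_eq_abs, hT₄]
    simp only
    have hbound : ∀ᵐ ω ∂μ.restrict (G n), ‖ρ n ω‖ ≤ C' * (B ω ^ 3 + B ω + 1) / (n : ℝ) ^ 3 := by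
      rw [ae_restrict_iff' (hGm n)]
      filter_upwards [hgn] with ω hω hωG
      rw [Real.norm_eq_abs]
      exact hω hωG
    have hIg : Integrable (fun ω ↦ C' * (B ω ^ 3 + B ω + 1) / (n : ℝ) ^ 3) (μ.restrict (G n)) := by
      have : (fun ω ↦ C' * (B ω ^ 3 + B ω + 1) / (n : ℝ) ^ 3) =
          fun ω ↦ C' / (n : ℝ) ^ 3 * (B ω ^ 3 + B ω + 1) := by funext ω; ring
      rw [this]; exact (hImom.const_mul _).integrableOn
    have h1 := norm_integral_le_of_norm_le hIg hbound
    rw [Real.norm_eq_abs] at h1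
    have h2 : ∫ ω in G n, C' * (B ω ^ 3 + B ω + 1) / (n : ℝ) ^ 3 ∂μ ≤ |C'| * Emom / (n : ℝ) ^ 3 := by
      have hC' : ∀ ω, C' * (B ω ^ 3 + B ω + 1) / (n : ℝ) ^ 3 ≤ |C'| / (n : ℝ) ^ 3 * (B ω ^ 3 + B ω + 1) := by
        intro ω
        have hm : 0 ≤ B ω ^ 3 + B ω + 1 := by have := hB0 ω; positivity
        rw [mul_div_right_comm]
        exact mul_le_mul_of_nonneg_right (div_le_div_of_nonneg_right (le_abs_self _) (by positivity)) hm
      calc ∫ ω in G n, C' * (B ω ^ 3 + B ω + 1) / (n : ℝ) ^ 3 ∂μ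
          ≤ ∫ ω in G n, |C'| / (n : ℝ) ^ 3 * (B ω ^ 3 + B ω + 1) ∂μ :=
            setIntegral_mono_on hIg ((hImom.const_mul _).integrableOn) (hGm n) (fun ω _ ↦ hC' ω)
        _ ≤ ∫ ω, |C'| / (n : ℝ) ^ 3 * (B ω ^ 3 + B ω + 1) ∂μ :=
            setIntegral_le_integral (hImom.const_mul _)
              (Eventually.of_forall fun ω ↦ by have := hB0 ω; positivity)
        _ = |C'| * Emom / (n : ℝ) ^ 3 := by rw [integral_const_mul]; ring
    calc |(n : ℝ) * ∫ ω in G n, ρ n ω ∂μ| = (n : ℝ) * |∫ ω in G n, ρ n ω ∂μ| := by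
          rw [abs_mul, abs_of_pos hnpos]
      _ ≤ (n : ℝ) * (|C'| * Emom / (n : ℝ) ^ 3) := mul_le_mul_of_nonneg_left (h1.trans h2) hnpos.le
      _ = |C'| * Emom * ((n : ℝ))⁻¹ ^ 2 := by field_simp
  have hL₅ : Tendsto T₅ atTop (𝓝 0) := by
    -- `|n ∫_{Gᶜ} h| ≤ C q · μ(Gᶜ) ≤ 8 |C| E[B³]/q²`
    have h0 : Tendsto (fun n : ℕ ↦ 8 * |C| * EB3 * ((q n) ^ 2)⁻¹) atTop (𝓝 0) := by
      have := tendsto_inv_scale_sq.const_mul (8 * |C| * EB3)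
      simpa using this
    refine squeeze_zero_norm' (a := fun n : ℕ ↦ 8 * |C| * EB3 * ((q n) ^ 2)⁻¹) ?_ h0
    filter_upwards [hhm, hsure, eventually_gt_atTop 0] with n hmn hsn hn0
    have hnpos : (0 : ℝ) < n := by exact_mod_cast hn0
    have hqpos : 0 < q n := Real.rpow_pos_of_pos hnpos _
    rw [Real.norm_eq_abs, hT₅]
    simp only
    have h1 : ‖∫ ω in (G n)ᶜ, h n ω ∂μ‖ ≤ |C| * q n / n * μ.real (G n)ᶜ := by
      refine norm_setIntegral_le_of_norm_le_const (measure_lt_top _ _) fun ω _ ↦ ?_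
      rw [Real.norm_eq_abs]
      refine (hsn ω).trans ?_
      gcongr
      exact le_abs_self C
    have h2 : μ.real (G n)ᶜ ≤ EB3 / (q n / 2) ^ 3 := measureReal_compl_good_le hB3 hB0 (by positivity)
    rw [Real.norm_eq_abs] at h1
    calc |(n : ℝ) * ∫ ω in (G n)ᶜ, h n ω ∂μ| = (n : ℝ) * |∫ ω in (G n)ᶜ, h n ω ∂μ| := by
          rw [abs_mul, abs_of_pos hnpos]
      _ ≤ (n : ℝ) * (|C| * q n / n * (EB3 / (q n / 2) ^ 3)) := by
          apply mul_le_mul_of_nonneg_left _ hnpos.le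
          exact h1.trans (mul_le_mul_of_nonneg_left h2 (by positivity))
      _ = 8 * |C| * EB3 * ((q n) ^ 2)⁻¹ := by field_simp; ring
  -- assemble
  have hsum : Tendsto (fun n ↦ T₁ n + T₂ n + T₃ n + T₄ n + T₅ n) atTop
      (𝓝 (0 + -(S₀ * ∫ ω, X ω ∂μ) + 0 + 0 + 0)) :=
    (((hL₁.add hL₂).add hL₃).add hL₄).add hL₅
  simp only [zero_add, add_zero] at hsum
  exact hsum.congr' (hdecomp.mono fun n hn ↦ hn.symm)

end Moments

/-- **Registered form** (glue sub-goal `farField_tendsto_first_moment` of stmt-CriticalPhenomena-0746):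
first moment of the stopped-modulus increment from the sure bound and the good-event expansion,
`n E[h n] → -S₀ E[X]`. [folklore] -/
theorem farField_tendsto_first_moment : ∀ {Ω : Type*} {mΩ : MeasurableSpace Ω} {μ : MeasureTheory.Measure Ω} [MeasureTheory.IsProbabilityMeasure μ] {X B : Ω → ℝ} {h : ℕ → Ω → ℝ} {S P D : ℕ → ℝ} {S₀ P₀ D₀ C C' : ℝ}, Measurable X → MeasureTheory.StronglyMeasurable B → MeasureTheory.MemLp B 3 μ → (∀ ω, 0 ≤ B ω) → (∀ᵐ ω ∂μ, |X ω| ≤ B ω) → (∀ᶠ n : ℕ in Filter.atTop, Measurable (h n)) → (∀ᶠ n : ℕ in Filter.atTop, ∀ ω, |h n ω| ≤ C * ((n : ℝ)) ^ (3 / 4 : ℝ) / n) → (∀ᶠ n : ℕ in Filter.atTop, ∀ᵐ ω ∂μ, B ω ≤ ((n : ℝ)) ^ (3 / 4 : ℝ) / 2 → |h n ω - D n + S n * (X ω / n) + P n * (X ω / n) ^ 2| ≤ C' * (B ω ^ 3 + B ω + 1) / (n : ℝ) ^ 3) → Filter.Tendsto S Filter.atTop (nhds S₀) → Filter.Tendsto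 P Filter.atTop (nhds P₀) → Filter.Tendsto (fun n : ℕ ↦ (n : ℝ) ^ 2 * D n) Filter.atTop (nhds D₀) → Filter.Tendsto (fun n : ℕ ↦ (n : ℝ) * ∫ ω, h n ω ∂μ) Filter.atTop (nhds (-(S₀ * ∫ ω, X ω ∂μ))) :=
  fun hXm hBm hB3 hB0 hXB hhm hsure hgood hS hP hD ↦
    tendsto_first_moment hXm hBm hB3 hB0 hXB hhm hsure hgood hS hP hD

end FarField

end Summit.CriticalPhenomena.CardyFormulaZ2.Cruxes.CardyRigidity.CrossingMartingale

end
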